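import Summits.ResolutionOfSingularities.ResolutionOfSingularities.Theorems.HilbertSamuelEliminationSigmaMaxModificationsCorridor3MovingCompactnessPersistence
import Summits.ResolutionOfSingularities.ResolutionOfSingularities.Theorems.HilbertSamuelEliminationSigmaMaxModificationsCorridor3MovingCompactnessCycleEnd
import HarnessLib

/-!
# Route `HilbertSamuelElimination`, crux `SigmaMaxModificationsCorridor3` (stmt-ResolutionOfSingularities-19249; child of
# `SigmaMaxModifications` stmt-…-18506), registered skeleton `w_ladder` v5/v5b MOVING (e55bf4f23146f08b / 15b216069fa8234a), stub
# `stub_movingCompactness` (L∞) — second layer, HELPER STUB 3 of idea-2's line `moving-compactness`, part 3/3: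
# `stub_movingChain_of_leastLabel_eventuallyConst` BY NAME AND SIGNATURE — least label eventually constant ⇒ SOME closed point of
# `X(ν)` starts a MOVING chain

[OURS · L1 W4.2] (cell res-hironaka, LADDER-RESOLUTION rung L, D-0089; reserve prover seat res-type-064 gen 10, holder of helper
stub 3 of `L/res-L1-w42-idea-2/Line-moving-compactness.lean` 89d540dcceefd65f on res-L1-w42-plan-1's word 04:28:23Z / 04:59:04Z;
cycle-end piece by res-type-005, p498054, split agreed 04:50:25Z). NOT statements of H. Hironaka's manuscript [Hironaka2017];
nothing of the manuscript is used or asserted. AI review is weaker than expert review. Pure PROOF file; no definition.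

THE ARGUMENT (persistence form; CJS Rem. 6.29 (1), (6.5), Step 7 p. 95, p. 105, p. 107). Let `c` be a chain of closed near points
of `S(X, ν)` from `x`, along which the least label present is `j` from the stage `n₀` on; put `n₁ := max n₀ (j + 1)`.
(1) The stages, labellings and cycle states of `c` are those of THE canonical runs (`exists_run_eq_of_chain`, functional oracle),
so `Y_m^{(j)} ≠ ∅` at the top of every canonical run of length `m ≥ n₁` (the least label is attained: the marked point keeps the
stratum non-empty). (2) By the Noetherian persistence of the parts (part 2/3: `exists_partPersistent_closedPt`,
`exists_next_pt_of_partPersistent`) some closed `x' ∈ X(ν)` threads closed stratum points `y_m ↦ y_{m-1}` along the same blow-ups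
with `y_m ∈ Y_m^{(j)}` for every `m ≥ n₁` — the RE-POINTED chain `c' m = {c m with pt := y_m}`. (3) By res-type-005's
`exists_cycleEnd_of_leastLabel_eventuallyConst`, beyond any stage some resolution cycle for the label `j` ENDS, its centre being
the whole part `Y_m^{(j)} ∋ y_m`: the marked point of `c'` is blown up there. Hence `c'` is blown up infinitely often.

* `year_eq_of_chain` — the year of the `n`-th stage of a chain from the initial marked stage is `n`.
* `exists_movingChain_of_leastLabel_eventuallyConst_of_cycleEnds` — the core, with the recurrence of label-`j` cycle ends as a
  hypothesis (steps (1)–(2) and the threading by dependent choice).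
* `stub_movingChain_of_leastLabel_eventuallyConst` — HELPER STUB 3 of the line, BY NAME AND SIGNATURE (the binder `hxcl` is not
  used by the proof and is spelled `_hxcl`; its type is verbatim).

With res-type-005's composition `movingCompactness_of_stub3` (p498231) this closes the registered stub `stub_movingCompactness :
Moving.MovingCompactness` by name (separate 3-line file `…Corridor3WLadderMovingCompactness.lean`, res-type-005's template).

## References

* V. Cossart, U. Jannsen, S. Saito, *Desingularization: Invariants and Strategy*, LNM 2270 (2020), Rem. 6.29 (1) pp. 91–92, (6.5),
  proof of Thm. 6.28 Step 7 p. 95, p. 105, p. 107. [CossartJannsenSaito2020]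
* tree: parts 1/3 `…MovingCompactnessRunLabelling` (p498069), 2/3 `…MovingCompactnessPersistence`; res-type-005's
  `…MovingCompactnessLeastLabel` (p496952), `…MovingCompactnessCycleEnd` (p498054); T∞ `…CampaignW42TertiaryCompactnessGeneral`.
* cell files: `L/w42/CHAIN.md` §0f (S2); `L/res-L1-w42-idea-2/Line-moving-compactness.lean` (sha16 89d540dcceefd65f).
-/

noncomputable section

set_option linter.dupNamespace false -- mandated namespace of this single-conjunct summit

open CategoryTheory AlgebraicGeometry TopologicalSpace Topology
open Summit.ResolutionOfSingularities.ResolutionOfSingularities.Theorems.CampaignW42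
open Literature.AlgebraicGeometry.Resolution Literature.RingTheory.HilbertSamuel

namespace Summit.ResolutionOfSingularities.ResolutionOfSingularities.Cruxes.SigmaMaxModifications.MovingCompactnessLine

universe u

variable {R : ∀ S : Scheme.{u}, CentreSeq S → Prop} {N : ℕ} {ν : ℕ → ℕ}
variable {k : Type u} [Field k]

/-- Along a chain of canonical near steps from the initial marked stage the year of the `n`-th stage is `n`. [folklore] -/
theorem year_eq_of_chain {X : Scheme.{u}} [IsLocallyNoetherian X] {x : X} {c : ℕ → MarkedStage.{u}}
    (h0 : c 0 = MarkedStage.init X x) (hstep : ∀ n, CanonicalNearStep R N ν (c n) (c (n + 1))) :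
    ∀ n, (c n).L.year = n
  | 0 => by rw [h0]; rfl
  | n + 1 => by
    obtain ⟨C, P', hln, x', -, -, -, -, h1⟩ := hstep n
    rw [h1]
    show (c n).L.year + 1 = n + 1
    rw [year_eq_of_chain h0 hstep n]

/-- **HELPER STUB 3, CORE (functional oracle, good initial state): least label eventually constant `= j` and label-`j`
cycle ENDS recurring along the chain ⇒ SOME closed point of `X(ν)` starts a MOVING chain.** The new chain is the given one
RE-POINTED, `c' n = {c n with pt := y n}` (same stages, labellings and cycle states): the points `y n` are threaded by the
Noetherian persistence of the label-`j` parts (`exists_partPersistent_closedPt`, `exists_next_pt_of_partPersistent`; the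
parts `Y_m^{(j)}` are non-empty for `m ≥ n₀` because `j` is the least label present, read at the top of THE canonical run by
`exists_run_eq_of_chain`), so that `y m ∈ Y_m^{(j)}` for every `m ≥ max n₀ (j + 1)`; at every later cycle END for the label
`j` (hypothesis `hcyc`: the canonical centre contains `Y_m^{(j)}`) the marked point is blown up.
[cite: CossartJannsenSaito2020, Rem. 6.29 (1), p. 105, p. 107] -/
theorem exists_movingChain_of_leastLabel_eventuallyConst_of_cycleEnds (hRf : OracleFunctional R) {X : Scheme.{u}}
    [IsLocallyNoetherian X] (hgood : StateGood k R N ν X (Labelling.init X) none) {x : X}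
    (hx : x ∈ Scheme.hsStratum X N ν) {c : ℕ → MarkedStage.{u}} (h0 : c 0 = MarkedStage.init X x)
    (hstep : ∀ n, CanonicalNearStep R N ν (c n) (c (n + 1))) {j n₀ : ℕ}
    (hj : ∀ n, n₀ ≤ n → leastLabel N ν (c n) = j)
    (hcyc : ∀ n, ∃ m, n ≤ m ∧ ∃ (C : (c m).W.IdealSheafData) (P' : Option (Pending (blowup C))),
      IsCanonicalStep R N ν (c m).L (c m).P C P' ∧
        (c m).L.part (Scheme.hsStratum (c m).W N ν) j ⊆ (C.support : Set (c m).W)) :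
    ∃ (x' : X) (c' : ℕ → MarkedStage.{u}), x' ∈ Scheme.hsStratum X N ν ∧ IsClosed ({x'} : Set X) ∧
      c' 0 = MarkedStage.init X x' ∧ (∀ n, CanonicalNearStep R N ν (c' n) (c' (n + 1))) ∧
      ∀ n, ∃ m, n ≤ m ∧ (c' m).IsBlownUp R N ν := by
  -- WLOG the chain starts LITERALLY at the initial marked stage (so that `X`-points are points of the `0`-th stage)
  let d : ℕ → MarkedStage.{u} := fun n => Nat.rec (motive := fun _ => MarkedStage.{u}) (MarkedStage.init X x)
    (fun m _ => c (m + 1)) n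
  have hd0 : d 0 = MarkedStage.init X x := rfl
  have hdstep : ∀ n, CanonicalNearStep R N ν (d n) (d (n + 1)) := by
    intro n
    cases n with
    | zero =>
      show CanonicalNearStep R N ν (MarkedStage.init X x) (c 1)
      rw [← h0]
      exact hstep 0
    | succ n => exact hstep (n + 1)
  -- the threshold year
  set n₁ := max n₀ (j + 1) with hn₁
  have hjn : j < n₁ := by omega
  have hdj : ∀ n, n₁ ≤ n → leastLabel N ν (d n) = j := by
    intro n hn
    cases n with
    | zero => omega
    | succ m => exact hj (m + 1) (by omega)
  have hinfX : CanonicalSequenceInfinite R N ν X := canonicalSequenceInfinite_of_chain hd0 hdstep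
  -- the label-`j` part is non-empty at the top of every long enough canonical run
  have hpart : ∀ t : CentreSeq X, t.IsCanonicalRun R N ν → n₁ ≤ (Labelling.init X).year + t.length →
      ((runLabelling N ν (Labelling.init X) t).part (Scheme.hsStratum t.top N ν) j).Nonempty := by
    intro t ht hlen
    obtain ⟨t', ht', hlen', h, P, y, hdm⟩ := exists_run_eq_of_chain t.length (MarkedStage.init X x) d hd0 hdstep
    have htt : t = t' := (CentreSeq.IsCanonicalRun.eq_of_length_eq hRf ht' ht hlen').symm
    subst htt
    have hm : n₁ ≤ t.length := by simpa using hlen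
    have hne : (Scheme.hsStratum (d t.length).W N ν).Nonempty := ⟨_, (invariants_of_chain hx hd0 hdstep _).2⟩
    have hp : ((d t.length).L.part (Scheme.hsStratum (d t.length).W N ν) j).Nonempty := by
      rw [← hdj _ hm]
      exact Nat.sInf_mem (((d t.length).L.exists_part_nonempty_iff _).mpr hne)
    exact (congrArg (fun s : MarkedStage.{u} => (s.L.part (Scheme.hsStratum s.W N ν) j).Nonempty) hdm).mp hp
  -- the initial point
  obtain ⟨x', hx'str, hx'cl, hpers₀⟩ := exists_partPersistent_closedPt hRf hjn hgood hinfX hpart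
  -- the invariant carried by the threaded points
  let G : ∀ s : MarkedStage.{u}, s.W → Prop := fun s y =>
    IsClosed ({y} : Set s.W) ∧ StateGood k R N ν s.W s.L s.P ∧
      (∀ m, ∃ t : CentreSeq s.W, IsCanonicalRunFrom R N ν s.L s.P t ∧ t.length = m) ∧
      ∀ t : CentreSeq s.W, IsCanonicalRunFrom R N ν s.L s.P t →
        ∃ z : t.top, (n₁ ≤ s.L.year + t.length →
            z ∈ (runLabelling N ν s.L t).part (Scheme.hsStratum t.top N ν) j) ∧
          z ∈ Scheme.hsStratum t.top N ν ∧ t.comp.base z = y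
  have hG0 : G (d 0) x' := ⟨hx'cl, hgood, hinfX, hpers₀⟩
  -- the successor step, along the given step `d n → d (n + 1)`
  have key : ∀ s s₁ : MarkedStage.{u}, CanonicalNearStep R N ν s s₁ → ∀ y : s.W, G s y →
      ∃ y₁ : s₁.W, G s₁ y₁ ∧ CanonicalNearStep R N ν {s with pt := y} {s₁ with pt := y₁} := by
    rintro s s₁ h y ⟨hycl, hyg, hyi, hyp⟩
    obtain ⟨C, P', hln, x₁, hst, -, -, -, rfl⟩ := h
    obtain ⟨y₁, hπ, hcl₁, hstr₁, hinf₁, hpers₁⟩ :=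
      exists_next_pt_of_partPersistent (s := {s with pt := y}) hRf hjn hycl hyg hyi hyp hst
    exact ⟨y₁, ⟨hcl₁, hyg.next hst, hinf₁, hpers₁⟩, C, P', hln, y₁, hst, hπ, hcl₁, hstr₁, rfl⟩
  have hsucc : ∀ (n : ℕ) (w : {y : (d n).W // G (d n) y}),
      ∃ w' : {y' : (d (n + 1)).W // G (d (n + 1)) y'},
        CanonicalNearStep R N ν {(d n) with pt := w.1} {(d (n + 1)) with pt := w'.1} := by
    rintro n ⟨y, hy⟩
    obtain ⟨y₁, hG₁, hst₁⟩ := key (d n) (d (n + 1)) (hdstep n) y hy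
    exact ⟨⟨y₁, hG₁⟩, hst₁⟩
  choose g hg using hsucc
  let v : ∀ n, {y : (d n).W // G (d n) y} := fun n =>
    Nat.rec (motive := fun n => {y : (d n).W // G (d n) y}) ⟨x', hG0⟩ (fun n w => g n w) n
  refine ⟨x', fun n => {(d n) with pt := (v n).1}, hx'str, hx'cl, rfl, fun n => hg n (v n), fun n => ?_⟩
  -- moving: a cycle END for the label `j` beyond `max n n₁` blows up the whole part, which contains the threaded point
  obtain ⟨m, hm, hcm⟩ := hcyc (max n n₁)
  obtain ⟨m, rfl⟩ : ∃ m', m = m' + 1 := ⟨m - 1, by omega⟩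
  obtain ⟨C, P', hst, hsub⟩ := hcm
  refine ⟨m + 1, by omega, C, P', hst, hsub ?_⟩
  -- the threaded point at this stage lies in the label-`j` part (persistence at depth `0`; the year is `m + 1 ≥ n₁`)
  obtain ⟨z, hzc, -, hzeq⟩ := (v (m + 1)).2.2.2.2 (CentreSeq.nil _) (isCanonicalRunFrom_nil _ _)
  have hyear : (d (m + 1)).L.year = m + 1 := year_eq_of_chain hd0 hdstep (m + 1)
  have hzp := hzc (by rw [hyear, CentreSeq.length_nil]; omega)
  simpa using (show (CentreSeq.nil (d (m + 1)).W).comp.base z = (v (m + 1)).1 from hzeq) ▸ hzp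


/-- **HELPER STUB 3 of idea-2's line `moving-compactness`, BY NAME AND SIGNATURE (M): if the least label present is eventually
constant `= j` along a chain of closed near points from `x`, SOME closed point of `X(ν)` starts a MOVING chain** (along the same
blow-ups) — the core `exists_movingChain_of_leastLabel_eventuallyConst_of_cycleEnds` fed with res-type-005's recurrence of
label-`j` cycle ends `exists_cycleEnd_of_leastLabel_eventuallyConst`. The hypothesis `IsClosed {x}` of the line's signature is not
needed by this proof (binder `_hxcl`, type verbatim). [cite: CossartJannsenSaito2020, Rem. 6.29 (1), p. 92, p. 105] -/
theorem stub_movingChain_of_leastLabel_eventuallyConst (hRf : OracleFunctional R) {X : Scheme.{u}} [IsLocallyNoetherian X]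
    (hgood : StateGood k R N ν X (Labelling.init X) none) {x : X} (hx : x ∈ Scheme.hsStratum X N ν)
    (_hxcl : IsClosed ({x} : Set X)) {c : ℕ → MarkedStage.{u}} (h0 : c 0 = MarkedStage.init X x)
    (hstep : ∀ n, CanonicalNearStep R N ν (c n) (c (n + 1)))
    (hconst : ∃ j n₀, ∀ n, n₀ ≤ n → leastLabel N ν (c n) = j) :
    ∃ (x' : X) (c' : ℕ → MarkedStage.{u}), x' ∈ Scheme.hsStratum X N ν ∧ IsClosed ({x'} : Set X) ∧
      c' 0 = MarkedStage.init X x' ∧ (∀ n, CanonicalNearStep R N ν (c' n) (c' (n + 1))) ∧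
      ∀ n, ∃ m, n ≤ m ∧ (c' m).IsBlownUp R N ν := by
  obtain ⟨j, n₀, hj⟩ := hconst
  exact exists_movingChain_of_leastLabel_eventuallyConst_of_cycleEnds hRf hgood hx h0 hstep hj
    (exists_cycleEnd_of_leastLabel_eventuallyConst hstep hj)

end Summit.ResolutionOfSingularities.ResolutionOfSingularities.Cruxes.SigmaMaxModifications.MovingCompactnessLine

end
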